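/-
Origin: written from primary sources — S. Kudla, *Seesaw dual reductive pairs* (1984) §1 (the see-saw identity: the
theta kernel of the big pair restricted to the product of the small groups is the product of the small kernels);
R. Howe, *θ-series and invariant theory* (1979) §2–§3; A. Weil, Acta Math. 111 (1964) Chap. III n° 41 Thm 6 p. 193
(`Θ(S) = Σ_ξ (SΦ)(ξ)` and its multiplicativity over `X₁ ⊕ X₂`); S. Gelbart, J. Rogawski, Invent. Math. 105 (1991)
§3.2 p. 457 (the theta kernel of a unitary dual pair). Adapted: no. This file composes `restrictTmul₁₂` / `restrictTmul₃₄`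
of `UnitaryDualPairSeesawSchemeSmall` with the multiplicativity `Θ(Φ₁ ⊠ Φ₂) = Θ(Φ₁) Θ(Φ₂)` of
`AdelicSchwartzBruhatDirectSum` and the read-backs `thetaDistLM_omega_seesawBigSum/ConjSum`. Kernel only; no records.
-/
import Literature.NumberTheory.GelbartRogawski1991.UnitaryDualPairSeesawSchemeSmall
import HarnessLib

/-!
# The see-saw identity of THETA KERNELS at the splitting data of record

For the three compatible splittings `s, s₁, s₂` of the unitary dual pairs `(U(J_V), U(J₁ ⊕ᶠ J₂))`, `(U(J_V), U(J₁))`,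
`(U(J_V), U(J₂))` (`UnitaryDualPairSeesawCharacter`, [GelbartRogawski1991, Prop. 3.1.1]) and the renormalised small
representations `ω_j′ := twist (charSmall_j) (ω ∘ pairSmall_j s_j)` of `UnitaryDualPairSeesawSchemeSmall` (scheme small):

* §0 (abstract, any three homomorphisms over the see-saw embedding) `thetaDistLM_mpSeesaw_tensorToSum`:
  `Θ(ω(s (g,(u₁,u₂))) (Φ₁ ⊠ Φ₂)) = Θ(ω₁′(g,u₁) Φ₁) · Θ(ω₂′(g,u₂) Φ₂)`, and with the see-saw character made explicit
  `= χ(g,(u₁,u₂)) · Θ(ω(s₁(g,u₁)) Φ₁) · Θ(ω(s₂(g,u₂)) Φ₂)`;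
* §1 the `(12)` torus AT THE DATA OF RECORD: **`thetaDistLM_pairRep_blockDiag_seesawTensor`** — for all `g, u₁, u₂, Φ₁, Φ₂`,
  `Θ(ω_ψ(s_pair(g, u₁ ⊕ᶠ u₂)) (Φ₁ ⊗ Φ₂)) = Θ(ω₁′(g,u₁) Φ₁) · Θ(ω₂′(g,u₂) Φ₂)`, where
  `Φ₁ ⊗ Φ₂ := seesawTensor Φ₁ Φ₂ = R_{e_W} R_f⁻¹ (Φ₁ ⊠ Φ₂) ∈ 𝒮(𝔸_F^n)` is the pure tensor read in the big pair's
  Schrödinger model of record — the THETA KERNEL of the big pair restricted to `U(J_V) × (U(J₁) × U(J₂))` is the product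
  of the two (renormalised) small theta kernels [Kudla1984, §1]; its antisymmetrised form
  **`thetaDistLM_pairRep_blockDiag_seesawWedge`** for the WEDGE test function
  `seesawWedge φ₁₁ φ₁₂ φ₂₁ φ₂₂ := φ₁₁ ⊗ φ₂₂ − φ₁₂ ⊗ φ₂₁` (the theta kernel is the `2 × 2` determinant of small kernels);
* §2 the CONJUGATED `(34)` torus: **`thetaDistLM_pairRep_isometryConj_seesawTensor₃₄`** — the same for
  `s_pair(v, g (u₁ ⊕ᶠ u₂) g⁻¹)` and the transformed pure tensor `R_{e_W} (ω(r_F h₀) (R_f⁻¹ (Φ₁ ⊠ Φ₂)))`.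

Provenance / use (Hodge-CM model-construction cell, rows `gen12`/`real34`; PKG consumer `Gen12FunBridge.wf_gen` of
`HodgeCM/Model/Binders/MeetBridges.lean`): §1 is the kernel identity `θ_{φ₁⊗φ₂}(g,(u₁,u₂)) = θ_{φ₁}(g,u₁) θ_{φ₂}(g,u₂)` of
PerL v5's Lemma «seesaw» (tex ll. 318–326) for the CONSTRUCTED adelic Weil representations — with the renormalisation of
the small pairs that the manuscript's `ω_W|_{T×G_U} ≅ ω_{W₁} ⊗ ω_{W₂}` leaves implicit made explicit (scheme small, node
W2-Kn); integrating it over `[U(J₁)] × [U(J₂)]` against `χ′₁ ⊠ χ′₂` (`Weil1964/ThetaLiftSeesawProduct`, Fubini on the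
compact torus quotient) gives (eq:seesaw) (tex ll. 323–325), i.e. the function-level see-saw `wf_gen`; §1's wedge form is
the kernel of the global wedge-function `u₁ ∧ u₂ = u₁¹u₂² − u₁²u₂¹` of two theta one-forms ((eq:Qaut), tex l. 249).  Nothing
here is a claim of the manuscripts under adjudication: kernel algebra over the tree's constructed objects.
-/

set_option autoImplicit false

noncomputable section

open scoped Matrix Kronecker
open NumberField
open Literature.RepresentationTheory Literature.RepresentationTheory.SeesawScalar
open Literature.RepresentationTheory.HeisenbergGroup
open Literature.NumberTheory.Automorphic
open Literature.NumberTheory.Automorphic.UnitaryGroup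
open Literature.NumberTheory.Weil1964

namespace Literature.NumberTheory.GelbartRogawski1991

namespace UnitaryDualPair

/-! ## §0 The theta functional of a see-saw restriction (abstract three homomorphisms) -/

section Abstract

variable {F : Type} [Field F] [NumberField F]
variable {ι₁ ι₂ : Type} [Fintype ι₁] [DecidableEq ι₁] [Fintype ι₂] [DecidableEq ι₂]
variable {T₁ : Matrix ι₁ ι₁ (AdeleRing (𝓞 F) F)} {T₂ : Matrix ι₂ ι₂ (AdeleRing (𝓞 F) F)}
variable {GV U₁ U₂ : Type*} [Group GV] [Group U₁] [Group U₂]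
  (s : GV × (U₁ × U₂) →* adelicMpCont F (ι₁ ⊕ ι₂) (Matrix.fromBlocks T₁ 0 0 T₂))
  (s₁ : GV × U₁ →* adelicMpCont F ι₁ T₁) (s₂ : GV × U₂ →* adelicMpCont F ι₂ T₂)
  (hs : ∀ (g : GV) (u₁ : U₁) (u₂ : U₂),
    adelicMpCont.proj F (ι₁ ⊕ ι₂) (Matrix.fromBlocks T₁ 0 0 T₂) (s (g, (u₁, u₂))) =
      UnitaryGroup.spSum T₁ T₂
        (adelicMpCont.proj F ι₁ T₁ (s₁ (g, u₁)), adelicMpCont.proj F ι₂ T₂ (s₂ (g, u₂))))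
  (hT₁ : IsUnit T₁) (hT₂ : IsUnit T₂)

/-- **The theta functional of the see-saw restriction is the product of the small ones** (scheme small): for all
`g, u₁, u₂, Φ₁, Φ₂`, `Θ(ω(s (g,(u₁,u₂))) (Φ₁ ⊠ Φ₂)) = Θ(ω₁′(g,u₁) Φ₁) · Θ(ω₂′(g,u₂) Φ₂)` with
`ω_j′ = twist (charSmall_j) (ω ∘ s_j)`. [cite: Kudla1984, §1] -/
theorem thetaDistLM_mpSeesaw_tensorToSum (g : GV) (u₁ : U₁) (u₂ : U₂) (Φ₁ : piSchwartzBruhat F ι₁)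
    (Φ₂ : piSchwartzBruhat F ι₂) :
    thetaDistLM F (ι₁ ⊕ ι₂)
        (adelicMpCont.omega F (ι₁ ⊕ ι₂) (Matrix.fromBlocks T₁ 0 0 T₂) (s (g, (u₁, u₂))) (tensorToSum F ι₁ ι₂ Φ₁ Φ₂)) =
      thetaDistLM F ι₁
          (SeesawScalar.twist (mpCharSmall₁ s s₁ s₂ hs hT₁ hT₂) ((adelicMpCont.omega F ι₁ T₁).comp s₁) (g, u₁) Φ₁) *
        thetaDistLM F ι₂
          (SeesawScalar.twist (mpCharSmall₂ s s₁ s₂ hs hT₁ hT₂) ((adelicMpCont.omega F ι₂ T₂).comp s₂) (g, u₂) Φ₂) :=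
  (congrArg (thetaDistLM F (ι₁ ⊕ ι₂)) (mpSeesaw_tensorToSum_twist_small s s₁ s₂ hs hT₁ hT₂ g u₁ u₂ Φ₁ Φ₂)).trans
    (thetaDistLM_tensorToSum _ _)

/-- **… with the see-saw character explicit**: `Θ(ω(s (g,(u₁,u₂))) (Φ₁ ⊠ Φ₂)) =
χ(g,(u₁,u₂)) · (Θ(ω(s₁(g,u₁)) Φ₁) · Θ(ω(s₂(g,u₂)) Φ₂))`. [cite: Howe1979, §3] -/
theorem thetaDistLM_mpSeesaw_tensorToSum_eq_char_mul (g : GV) (u₁ : U₁) (u₂ : U₂) (Φ₁ : piSchwartzBruhat F ι₁)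
    (Φ₂ : piSchwartzBruhat F ι₂) :
    thetaDistLM F (ι₁ ⊕ ι₂)
        (adelicMpCont.omega F (ι₁ ⊕ ι₂) (Matrix.fromBlocks T₁ 0 0 T₂) (s (g, (u₁, u₂))) (tensorToSum F ι₁ ι₂ Φ₁ Φ₂)) =
      (mpSeesawChar₃ s s₁ s₂ hs hT₁ hT₂ (g, (u₁, u₂)) : ℂ) *
        (thetaDistLM F ι₁ (adelicMpCont.omega F ι₁ T₁ (s₁ (g, u₁)) Φ₁) *
          thetaDistLM F ι₂ (adelicMpCont.omega F ι₂ T₂ (s₂ (g, u₂)) Φ₂)) := by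
  refine (congrArg (thetaDistLM F (ι₁ ⊕ ι₂)) (mpSeesawChar₃_spec s s₁ s₂ hs hT₁ hT₂ g u₁ u₂ Φ₁ Φ₂)).trans ?_
  refine (LinearMap.map_smul (thetaDistLM F (ι₁ ⊕ ι₂)) _ _).trans ?_
  exact congrArg (fun t : ℂ => (mpSeesawChar₃ s s₁ s₂ hs hT₁ hT₂ (g, (u₁, u₂)) : ℂ) * t)
    (thetaDistLM_tensorToSum _ _)

end Abstract

/-! ## §1 The `(12)` torus at the splitting data of record -/

section Twelve

variable (F E : Type) [Field F] [NumberField F] [Field E] [NumberField E] [Algebra F E]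
variable (c : E ≃ₐ[F] E) (N M₁ M₂ : ℕ) {n n₁ n₂ : ℕ}
  (eW : Fin N × Fin (M₁ + M₂) ≃ Fin n) (e₁ : Fin N × Fin M₁ ≃ Fin n₁) (e₂ : Fin N × Fin M₂ ≃ Fin n₂)
variable (JV : Matrix (Fin N) (Fin N) E) (J₁ : Matrix (Fin M₁) (Fin M₁) E) (J₂ : Matrix (Fin M₂) (Fin M₂) E)
variable {TV : Matrix (Fin N) (Fin N) F} {T₁ : Matrix (Fin M₁) (Fin M₁) F} {T₂ : Matrix (Fin M₂) (Fin M₂) F}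

/-- **the pure tensor `Φ₁ ⊗ Φ₂` read in the big pair's Schrödinger model of record** `𝒮(𝔸_F^n)`:
`R_{e_W} (R_f⁻¹ (Φ₁ ⊠ Φ₂))`, `f = finProdSumEquiv N M₁ M₂` (bilinear). [folklore] -/
def seesawTensor :
    piSchwartzBruhat F (Fin N × Fin M₁) →ₗ[ℂ] piSchwartzBruhat F (Fin N × Fin M₂) →ₗ[ℂ] piSchwartzBruhat F (Fin n) :=
  (tensorToSum F (Fin N × Fin M₁) (Fin N × Fin M₂)).compr₂
    ((piSBReindex F eW).toLinearMap ∘ₗ ((piSBReindex F (finProdSumEquiv N M₁ M₂)).symm).toLinearMap)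

/-- Unfolding: `seesawTensor Φ₁ Φ₂ = R_{e_W} (R_f⁻¹ (Φ₁ ⊠ Φ₂))`. [folklore] -/
theorem seesawTensor_apply (Φ₁ : piSchwartzBruhat F (Fin N × Fin M₁)) (Φ₂ : piSchwartzBruhat F (Fin N × Fin M₂)) :
    seesawTensor F N M₁ M₂ eW Φ₁ Φ₂ =
      piSBReindex F eW ((piSBReindex F (finProdSumEquiv N M₁ M₂)).symm
        (tensorToSum F (Fin N × Fin M₁) (Fin N × Fin M₂) Φ₁ Φ₂)) :=
  rfl

/-- **the WEDGE test function** `φ₁₁ ⊗ φ₂₂ − φ₁₂ ⊗ φ₂₁ ∈ 𝒮(𝔸_F^n)` of two pairs of Schwartz–Bruhat functions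
(the antisymmetrised pure tensor whose theta kernel on the `(12)` torus is the `2 × 2` determinant of small kernels).
[folklore] -/
def seesawWedge (φ₁₁ φ₁₂ : piSchwartzBruhat F (Fin N × Fin M₁)) (φ₂₁ φ₂₂ : piSchwartzBruhat F (Fin N × Fin M₂)) :
    piSchwartzBruhat F (Fin n) :=
  seesawTensor F N M₁ M₂ eW φ₁₁ φ₂₂ - seesawTensor F N M₁ M₂ eW φ₁₂ φ₂₁

/-- Unfolding. [folklore] -/
theorem seesawWedge_def (φ₁₁ φ₁₂ : piSchwartzBruhat F (Fin N × Fin M₁))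
    (φ₂₁ φ₂₂ : piSchwartzBruhat F (Fin N × Fin M₂)) :
    seesawWedge F N M₁ M₂ eW φ₁₁ φ₁₂ φ₂₁ φ₂₂ =
      seesawTensor F N M₁ M₂ eW φ₁₁ φ₂₂ - seesawTensor F N M₁ M₂ eW φ₁₂ φ₂₁ :=
  rfl

/-- The wedge is antisymmetric under swapping the two columns. [folklore] -/
theorem seesawWedge_swap (φ₁₁ φ₁₂ : piSchwartzBruhat F (Fin N × Fin M₁))
    (φ₂₁ φ₂₂ : piSchwartzBruhat F (Fin N × Fin M₂)) :
    seesawWedge F N M₁ M₂ eW φ₁₂ φ₁₁ φ₂₂ φ₂₁ = -seesawWedge F N M₁ M₂ eW φ₁₁ φ₁₂ φ₂₁ φ₂₂ :=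
  (neg_sub _ _).symm

/-- The wedge of a repeated column vanishes. [folklore] -/
theorem seesawWedge_self (φ₁ : piSchwartzBruhat F (Fin N × Fin M₁)) (φ₂ : piSchwartzBruhat F (Fin N × Fin M₂)) :
    seesawWedge F N M₁ M₂ eW φ₁ φ₁ φ₂ φ₂ = 0 :=
  sub_self _

variable [Algebra.IsQuadraticExtension F E] {δ : E} (hcδ : c δ = -δ) (hδ : δ ≠ 0) {d : F}
  (hd : δ * δ = algebraMap F E d) (hV : TV.IsSymm) (h₁ : T₁.IsSymm) (h₂ : T₂.IsSymm) (hVd : IsUnit TV.det)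
  (h₁d : IsUnit T₁.det) (h₂d : IsUnit T₂.det) (hWd : IsUnit (finSum M₁ M₂ T₁ T₂).det)
  (hJV : JV = TV.map (algebraMap F E)) (hJ₁ : J₁ = T₁.map (algebraMap F E)) (hJ₂ : J₂ = T₂.map (algebraMap F E))
  {s : adelicPair F E c N (M₁ + M₂) JV (finSum M₁ M₂ J₁ J₂) →*
    adelicMpCont F (Fin n) (adelicGram F eW TV (finSum M₁ M₂ T₁ T₂))}
  {s₁ : adelicPair F E c N M₁ JV J₁ →* adelicMpCont F (Fin n₁) (adelicGram F e₁ TV T₁)}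
  {s₂ : adelicPair F E c N M₂ JV J₂ →* adelicMpCont F (Fin n₂) (adelicGram F e₂ TV T₂)}
  (hs : (splittingDatum F E c N (M₁ + M₂) eW JV (finSum M₁ M₂ J₁ J₂) hcδ hδ hd hV (isSymm_finSum h₁ h₂) hVd hWd hJV
    (finSum_eq_map_finSum F E M₁ M₂ J₁ J₂ hJ₁ hJ₂)).IsCompatible s)
  (hs₁ : (splittingDatum F E c N M₁ e₁ JV J₁ hcδ hδ hd hV h₁ hVd h₁d hJV hJ₁).IsCompatible s₁)
  (hs₂ : (splittingDatum F E c N M₂ e₂ JV J₂ hcδ hδ hd hV h₂ hVd h₂d hJV hJ₂).IsCompatible s₂)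

/-- **`ω₁′` — the renormalised Weil representation of the first small pair `(U(J_V), U(J₁))`** on
`U(J_V)(𝔸) × U(J₁)(𝔸)` (scheme small: `ω ∘ pairSmall₁ s₁` twisted by `(g,u₁) ↦ λ_V g · λ₁ u₁`).
(cf. R. Howe (1979) §3) [folklore] -/
def seesawRep₁ : Representation ℂ (adelic F E c N JV × adelic F E c M₁ J₁) (piSchwartzBruhat F (Fin N × Fin M₁)) :=
  SeesawScalar.twist
    (mpCharSmall₁ (seesawBigSum F E c N M₁ M₂ eW JV J₁ J₂ s) (pairSmall₁ F E c N M₁ e₁ JV J₁ s₁)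
      (pairSmall₂ F E c N M₂ e₂ JV J₂ s₂)
      (hs₃_seesaw F E c N M₁ M₂ eW e₁ e₂ JV J₁ J₂ hcδ hδ hd hV h₁ h₂ hVd h₁d h₂d hWd hJV hJ₁ hJ₂ hs hs₁ hs₂)
      (isUnit_kronecker_map F N hVd h₁d) (isUnit_kronecker_map F N hVd h₂d))
    ((adelicMpCont.omega F (Fin N × Fin M₁)
      (TV.map (algebraMap F (AdeleRing (𝓞 F) F)) ⊗ₖ T₁.map (algebraMap F (AdeleRing (𝓞 F) F)))).comp
      (pairSmall₁ F E c N M₁ e₁ JV J₁ s₁))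

/-- **`ω₂′` — the renormalised Weil representation of the second small pair `(U(J_V), U(J₂))`** on
`U(J_V)(𝔸) × U(J₂)(𝔸)` (scheme small: `ω ∘ pairSmall₂ s₂` twisted by `(g,u₂) ↦ λ₂ u₂`).
(cf. R. Howe (1979) §3) [folklore] -/
def seesawRep₂ : Representation ℂ (adelic F E c N JV × adelic F E c M₂ J₂) (piSchwartzBruhat F (Fin N × Fin M₂)) :=
  SeesawScalar.twist
    (mpCharSmall₂ (seesawBigSum F E c N M₁ M₂ eW JV J₁ J₂ s) (pairSmall₁ F E c N M₁ e₁ JV J₁ s₁)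
      (pairSmall₂ F E c N M₂ e₂ JV J₂ s₂)
      (hs₃_seesaw F E c N M₁ M₂ eW e₁ e₂ JV J₁ J₂ hcδ hδ hd hV h₁ h₂ hVd h₁d h₂d hWd hJV hJ₁ hJ₂ hs hs₁ hs₂)
      (isUnit_kronecker_map F N hVd h₁d) (isUnit_kronecker_map F N hVd h₂d))
    ((adelicMpCont.omega F (Fin N × Fin M₂)
      (TV.map (algebraMap F (AdeleRing (𝓞 F) F)) ⊗ₖ T₂.map (algebraMap F (AdeleRing (𝓞 F) F)))).comp
      (pairSmall₂ F E c N M₂ e₂ JV J₂ s₂))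

/-- `ω₁′(g,u₁) Φ₁ = (λ_V g · λ₁ u₁) • ω(pairSmall₁ s₁ (g,u₁)) Φ₁`. [folklore] -/
theorem seesawRep₁_apply (g : adelic F E c N JV) (u₁ : adelic F E c M₁ J₁) (Φ₁ : piSchwartzBruhat F (Fin N × Fin M₁)) :
    seesawRep₁ F E c N M₁ M₂ eW e₁ e₂ JV J₁ J₂ hcδ hδ hd hV h₁ h₂ hVd h₁d h₂d hWd hJV hJ₁ hJ₂ hs hs₁ hs₂ (g, u₁) Φ₁ =
      ((charV₁₂ F E c N M₁ M₂ eW e₁ e₂ JV J₁ J₂ hcδ hδ hd hV h₁ h₂ hVd h₁d h₂d hWd hJV hJ₁ hJ₂ hs hs₁ hs₂ g *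
          char₁ F E c N M₁ M₂ eW e₁ e₂ JV J₁ J₂ hcδ hδ hd hV h₁ h₂ hVd h₁d h₂d hWd hJV hJ₁ hJ₂ hs hs₁ hs₂ u₁ : ℂˣ) : ℂ) •
        adelicMpCont.omega F (Fin N × Fin M₁)
          (TV.map (algebraMap F (AdeleRing (𝓞 F) F)) ⊗ₖ T₁.map (algebraMap F (AdeleRing (𝓞 F) F)))
          (pairSmall₁ F E c N M₁ e₁ JV J₁ s₁ (g, u₁)) Φ₁ :=
  (SeesawScalar.twist_apply _ _ (g, u₁) Φ₁).trans
    (congrArg (fun χ : ℂˣ => (χ : ℂ) • adelicMpCont.omega F (Fin N × Fin M₁)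
        (TV.map (algebraMap F (AdeleRing (𝓞 F) F)) ⊗ₖ T₁.map (algebraMap F (AdeleRing (𝓞 F) F)))
        (pairSmall₁ F E c N M₁ e₁ JV J₁ s₁ (g, u₁)) Φ₁)
      (mpCharSmall₁_apply_eq_mul _ _ _ _ _ _ g u₁))

/-- `ω₂′(g,u₂) Φ₂ = λ₂ u₂ • ω(pairSmall₂ s₂ (g,u₂)) Φ₂`. [folklore] -/
theorem seesawRep₂_apply (g : adelic F E c N JV) (u₂ : adelic F E c M₂ J₂) (Φ₂ : piSchwartzBruhat F (Fin N × Fin M₂)) :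
    seesawRep₂ F E c N M₁ M₂ eW e₁ e₂ JV J₁ J₂ hcδ hδ hd hV h₁ h₂ hVd h₁d h₂d hWd hJV hJ₁ hJ₂ hs hs₁ hs₂ (g, u₂) Φ₂ =
      ((char₂ F E c N M₁ M₂ eW e₁ e₂ JV J₁ J₂ hcδ hδ hd hV h₁ h₂ hVd h₁d h₂d hWd hJV hJ₁ hJ₂ hs hs₁ hs₂ u₂ : ℂˣ) : ℂ) •
        adelicMpCont.omega F (Fin N × Fin M₂)
          (TV.map (algebraMap F (AdeleRing (𝓞 F) F)) ⊗ₖ T₂.map (algebraMap F (AdeleRing (𝓞 F) F)))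
          (pairSmall₂ F E c N M₂ e₂ JV J₂ s₂ (g, u₂)) Φ₂ :=
  SeesawScalar.twist_apply _ _ (g, u₂) Φ₂

/-- **See-saw of theta kernels in block-sum coordinates**: `Θ(ω(seesawBigSum s (g,(u₁,u₂))) (Φ₁ ⊠ Φ₂)) =
Θ(ω₁′(g,u₁) Φ₁) · Θ(ω₂′(g,u₂) Φ₂)`. [cite: Kudla1984, §1] -/
theorem thetaDistLM_omega_seesawBigSum_tensorToSum (g : adelic F E c N JV) (u₁ : adelic F E c M₁ J₁)
    (u₂ : adelic F E c M₂ J₂) (Φ₁ : piSchwartzBruhat F (Fin N × Fin M₁)) (Φ₂ : piSchwartzBruhat F (Fin N × Fin M₂)) :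
    thetaDistLM F ((Fin N × Fin M₁) ⊕ (Fin N × Fin M₂))
        (adelicMpCont.omega F ((Fin N × Fin M₁) ⊕ (Fin N × Fin M₂))
          (Matrix.fromBlocks (TV.map (algebraMap F (AdeleRing (𝓞 F) F)) ⊗ₖ T₁.map (algebraMap F (AdeleRing (𝓞 F) F))) 0 0
            (TV.map (algebraMap F (AdeleRing (𝓞 F) F)) ⊗ₖ T₂.map (algebraMap F (AdeleRing (𝓞 F) F))))
          (seesawBigSum F E c N M₁ M₂ eW JV J₁ J₂ s (g, (u₁, u₂)))
          (tensorToSum F (Fin N × Fin M₁) (Fin N × Fin M₂) Φ₁ Φ₂)) =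
      thetaDistLM F (Fin N × Fin M₁)
          (seesawRep₁ F E c N M₁ M₂ eW e₁ e₂ JV J₁ J₂ hcδ hδ hd hV h₁ h₂ hVd h₁d h₂d hWd hJV hJ₁ hJ₂ hs hs₁ hs₂ (g, u₁) Φ₁) *
        thetaDistLM F (Fin N × Fin M₂)
          (seesawRep₂ F E c N M₁ M₂ eW e₁ e₂ JV J₁ J₂ hcδ hδ hd hV h₁ h₂ hVd h₁d h₂d hWd hJV hJ₁ hJ₂ hs hs₁ hs₂ (g, u₂) Φ₂) :=
  thetaDistLM_mpSeesaw_tensorToSum _ _ _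
    (hs₃_seesaw F E c N M₁ M₂ eW e₁ e₂ JV J₁ J₂ hcδ hδ hd hV h₁ h₂ hVd h₁d h₂d hWd hJV hJ₁ hJ₂ hs hs₁ hs₂) _ _ g u₁ u₂ Φ₁ Φ₂

/-- **THE SEE-SAW IDENTITY OF THETA KERNELS AT THE DATA OF RECORD, `(12)` torus**: for all `g, u₁, u₂, Φ₁, Φ₂`,
`Θ(ω_ψ(s_pair(g, u₁ ⊕ᶠ u₂)) (Φ₁ ⊗ Φ₂)) = Θ(ω₁′(g,u₁) Φ₁) · Θ(ω₂′(g,u₂) Φ₂)` — the theta kernel of the big pair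
`(U(J_V), U(J₁ ⊕ᶠ J₂))` restricted to `U(J_V) × (U(J₁) × U(J₂))` is the product of the two renormalised small kernels.
[cite: Kudla1984, §1] -/
theorem thetaDistLM_pairRep_blockDiag_seesawTensor (g : adelic F E c N JV) (u₁ : adelic F E c M₁ J₁)
    (u₂ : adelic F E c M₂ J₂) (Φ₁ : piSchwartzBruhat F (Fin N × Fin M₁)) (Φ₂ : piSchwartzBruhat F (Fin N × Fin M₂)) :
    thetaDistLM F (Fin n)
        (adelicMpCont.omega F (Fin n) (adelicGram F eW TV (finSum M₁ M₂ T₁ T₂))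
          (pairSplitting F E c N (M₁ + M₂) eW JV (finSum M₁ M₂ J₁ J₂) s
            (g, adelicBlockDiag F E c M₁ M₂ J₁ J₂ (u₁, u₂)))
          (seesawTensor F N M₁ M₂ eW Φ₁ Φ₂)) =
      thetaDistLM F (Fin N × Fin M₁)
          (seesawRep₁ F E c N M₁ M₂ eW e₁ e₂ JV J₁ J₂ hcδ hδ hd hV h₁ h₂ hVd h₁d h₂d hWd hJV hJ₁ hJ₂ hs hs₁ hs₂ (g, u₁) Φ₁) *
        thetaDistLM F (Fin N × Fin M₂)
          (seesawRep₂ F E c N M₁ M₂ eW e₁ e₂ JV J₁ J₂ hcδ hδ hd hV h₁ h₂ hVd h₁d h₂d hWd hJV hJ₁ hJ₂ hs hs₁ hs₂ (g, u₂) Φ₂) :=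
  (thetaDistLM_omega_seesawBigSum F E c N M₁ M₂ eW JV J₁ J₂ (s := s) (g, (u₁, u₂))
      (tensorToSum F (Fin N × Fin M₁) (Fin N × Fin M₂) Φ₁ Φ₂)).symm.trans
    (thetaDistLM_omega_seesawBigSum_tensorToSum F E c N M₁ M₂ eW e₁ e₂ JV J₁ J₂ hcδ hδ hd hV h₁ h₂ hVd h₁d h₂d hWd
      hJV hJ₁ hJ₂ hs hs₁ hs₂ g u₁ u₂ Φ₁ Φ₂)

/-- **… with the see-saw character explicit**: `Θ(ω_ψ(s_pair(g, u₁ ⊕ᶠ u₂)) (Φ₁ ⊗ Φ₂)) =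
(λ_V g · λ₁ u₁ · λ₂ u₂) · Θ(ω(pairSmall₁ s₁ (g,u₁)) Φ₁) · Θ(ω(pairSmall₂ s₂ (g,u₂)) Φ₂)` — the product of the UNRENORMALISED
small kernels up to the automorphic see-saw character. [cite: Howe1979, §3] -/
theorem thetaDistLM_pairRep_blockDiag_seesawTensor_eq_char_mul (g : adelic F E c N JV) (u₁ : adelic F E c M₁ J₁)
    (u₂ : adelic F E c M₂ J₂) (Φ₁ : piSchwartzBruhat F (Fin N × Fin M₁)) (Φ₂ : piSchwartzBruhat F (Fin N × Fin M₂)) :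
    thetaDistLM F (Fin n)
        (adelicMpCont.omega F (Fin n) (adelicGram F eW TV (finSum M₁ M₂ T₁ T₂))
          (pairSplitting F E c N (M₁ + M₂) eW JV (finSum M₁ M₂ J₁ J₂) s
            (g, adelicBlockDiag F E c M₁ M₂ J₁ J₂ (u₁, u₂)))
          (seesawTensor F N M₁ M₂ eW Φ₁ Φ₂)) =
      ((charV₁₂ F E c N M₁ M₂ eW e₁ e₂ JV J₁ J₂ hcδ hδ hd hV h₁ h₂ hVd h₁d h₂d hWd hJV hJ₁ hJ₂ hs hs₁ hs₂ g *
            char₁ F E c N M₁ M₂ eW e₁ e₂ JV J₁ J₂ hcδ hδ hd hV h₁ h₂ hVd h₁d h₂d hWd hJV hJ₁ hJ₂ hs hs₁ hs₂ u₁ *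
          char₂ F E c N M₁ M₂ eW e₁ e₂ JV J₁ J₂ hcδ hδ hd hV h₁ h₂ hVd h₁d h₂d hWd hJV hJ₁ hJ₂ hs hs₁ hs₂ u₂ : ℂˣ) : ℂ) *
        (thetaDistLM F (Fin N × Fin M₁)
            (adelicMpCont.omega F (Fin N × Fin M₁)
              (TV.map (algebraMap F (AdeleRing (𝓞 F) F)) ⊗ₖ T₁.map (algebraMap F (AdeleRing (𝓞 F) F)))
              (pairSmall₁ F E c N M₁ e₁ JV J₁ s₁ (g, u₁)) Φ₁) *
          thetaDistLM F (Fin N × Fin M₂)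
            (adelicMpCont.omega F (Fin N × Fin M₂)
              (TV.map (algebraMap F (AdeleRing (𝓞 F) F)) ⊗ₖ T₂.map (algebraMap F (AdeleRing (𝓞 F) F)))
              (pairSmall₂ F E c N M₂ e₂ JV J₂ s₂ (g, u₂)) Φ₂)) :=
  (thetaDistLM_omega_seesawBigSum F E c N M₁ M₂ eW JV J₁ J₂ (s := s) (g, (u₁, u₂))
      (tensorToSum F (Fin N × Fin M₁) (Fin N × Fin M₂) Φ₁ Φ₂)).symm.trans
    ((thetaDistLM_mpSeesaw_tensorToSum_eq_char_mul _ _ _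
        (hs₃_seesaw F E c N M₁ M₂ eW e₁ e₂ JV J₁ J₂ hcδ hδ hd hV h₁ h₂ hVd h₁d h₂d hWd hJV hJ₁ hJ₂ hs hs₁ hs₂) _ _
        g u₁ u₂ Φ₁ Φ₂).trans
      (congrArg (fun χ : ℂˣ => (χ : ℂ) *
          (thetaDistLM F (Fin N × Fin M₁)
              (adelicMpCont.omega F (Fin N × Fin M₁)
                (TV.map (algebraMap F (AdeleRing (𝓞 F) F)) ⊗ₖ T₁.map (algebraMap F (AdeleRing (𝓞 F) F)))
                (pairSmall₁ F E c N M₁ e₁ JV J₁ s₁ (g, u₁)) Φ₁) *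
            thetaDistLM F (Fin N × Fin M₂)
              (adelicMpCont.omega F (Fin N × Fin M₂)
                (TV.map (algebraMap F (AdeleRing (𝓞 F) F)) ⊗ₖ T₂.map (algebraMap F (AdeleRing (𝓞 F) F)))
                (pairSmall₂ F E c N M₂ e₂ JV J₂ s₂ (g, u₂)) Φ₂)))
        (mpSeesawChar₃_factor _ _ _ _ _ _ g u₁ u₂)))

/-- **The WEDGE form**: `Θ(ω_ψ(s_pair(g, u₁ ⊕ᶠ u₂)) (φ₁₁ ⊗ φ₂₂ − φ₁₂ ⊗ φ₂₁)) =
Θ(ω₁′(g,u₁) φ₁₁) Θ(ω₂′(g,u₂) φ₂₂) − Θ(ω₁′(g,u₁) φ₁₂) Θ(ω₂′(g,u₂) φ₂₁)` — on the `(12)` torus the theta kernel of the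
wedge test function is the `2 × 2` determinant of the small kernels (the kernel of the global wedge-function of two theta
one-forms). [cite: Kudla1984, §1] -/
theorem thetaDistLM_pairRep_blockDiag_seesawWedge (g : adelic F E c N JV) (u₁ : adelic F E c M₁ J₁)
    (u₂ : adelic F E c M₂ J₂) (φ₁₁ φ₁₂ : piSchwartzBruhat F (Fin N × Fin M₁))
    (φ₂₁ φ₂₂ : piSchwartzBruhat F (Fin N × Fin M₂)) :
    thetaDistLM F (Fin n)
        (adelicMpCont.omega F (Fin n) (adelicGram F eW TV (finSum M₁ M₂ T₁ T₂))
          (pairSplitting F E c N (M₁ + M₂) eW JV (finSum M₁ M₂ J₁ J₂) s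
            (g, adelicBlockDiag F E c M₁ M₂ J₁ J₂ (u₁, u₂)))
          (seesawWedge F N M₁ M₂ eW φ₁₁ φ₁₂ φ₂₁ φ₂₂)) =
      thetaDistLM F (Fin N × Fin M₁)
            (seesawRep₁ F E c N M₁ M₂ eW e₁ e₂ JV J₁ J₂ hcδ hδ hd hV h₁ h₂ hVd h₁d h₂d hWd hJV hJ₁ hJ₂ hs hs₁ hs₂ (g, u₁) φ₁₁) *
          thetaDistLM F (Fin N × Fin M₂)
            (seesawRep₂ F E c N M₁ M₂ eW e₁ e₂ JV J₁ J₂ hcδ hδ hd hV h₁ h₂ hVd h₁d h₂d hWd hJV hJ₁ hJ₂ hs hs₁ hs₂ (g, u₂) φ₂₂) -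
        thetaDistLM F (Fin N × Fin M₁)
            (seesawRep₁ F E c N M₁ M₂ eW e₁ e₂ JV J₁ J₂ hcδ hδ hd hV h₁ h₂ hVd h₁d h₂d hWd hJV hJ₁ hJ₂ hs hs₁ hs₂ (g, u₁) φ₁₂) *
          thetaDistLM F (Fin N × Fin M₂)
            (seesawRep₂ F E c N M₁ M₂ eW e₁ e₂ JV J₁ J₂ hcδ hδ hd hV h₁ h₂ hVd h₁d h₂d hWd hJV hJ₁ hJ₂ hs hs₁ hs₂ (g, u₂) φ₂₁) :=
  (congrArg (thetaDistLM F (Fin n)) (map_sub (adelicMpCont.omega F (Fin n) (adelicGram F eW TV (finSum M₁ M₂ T₁ T₂))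
      (pairSplitting F E c N (M₁ + M₂) eW JV (finSum M₁ M₂ J₁ J₂) s (g, adelicBlockDiag F E c M₁ M₂ J₁ J₂ (u₁, u₂))))
      (seesawTensor F N M₁ M₂ eW φ₁₁ φ₂₂) (seesawTensor F N M₁ M₂ eW φ₁₂ φ₂₁))).trans
    ((map_sub (thetaDistLM F (Fin n)) _ _).trans
      (congrArg₂ (· - ·)
        (thetaDistLM_pairRep_blockDiag_seesawTensor F E c N M₁ M₂ eW e₁ e₂ JV J₁ J₂ hcδ hδ hd hV h₁ h₂ hVd h₁d h₂d hWd
          hJV hJ₁ hJ₂ hs hs₁ hs₂ g u₁ u₂ φ₁₁ φ₂₂)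
        (thetaDistLM_pairRep_blockDiag_seesawTensor F E c N M₁ M₂ eW e₁ e₂ JV J₁ J₂ hcδ hδ hd hV h₁ h₂ hVd h₁d h₂d hWd
          hJV hJ₁ hJ₂ hs hs₁ hs₂ g u₁ u₂ φ₁₂ φ₂₁)))

/-! ### The `(12)` see-saw on the constructed theta-KERNEL DATUM of the big pair -/

omit [NumberField F] [Algebra.IsQuadraticExtension F E] in
/-- inverses pass through `u₁ ⊕ᶠ u₂`: `(x, u₁ ⊕ᶠ u₂)⁻¹ = (x⁻¹, u₁⁻¹ ⊕ᶠ u₂⁻¹)`. [folklore] -/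
theorem prod_blockDiag_inv (x : adelic F E c N JV) (u₁ : adelic F E c M₁ J₁) (u₂ : adelic F E c M₂ J₂) :
    (x, adelicBlockDiag F E c M₁ M₂ J₁ J₂ (u₁, u₂))⁻¹ = (x⁻¹, adelicBlockDiag F E c M₁ M₂ J₁ J₂ (u₁⁻¹, u₂⁻¹)) :=
  Prod.ext rfl (map_inv (adelicBlockDiag F E c M₁ M₂ J₁ J₂) (u₁, u₂)).symm

/-- **The theta KERNEL of the big pair `(U(J_V), U(J₁ ⊕ᶠ J₂))` (tree `thetaKernelDatum`, [GelbartRogawski1991, §3.2])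
restricted to the `(12)` torus**: `θ_{Φ₁ ⊗ Φ₂}(x, u₁ ⊕ᶠ u₂) = Θ(ω₁′(x⁻¹,u₁⁻¹) Φ₁) · Θ(ω₂′(x⁻¹,u₂⁻¹) Φ₂)` — the product of
the two renormalised small kernels `θ′_{Φ_j}(x, u_j) = Θ(ω_j′((x,u_j)⁻¹) Φ_j)` in the tree's convention
`θ_Φ(x, h) = Θ(ω(s_pair(x⁻¹, h⁻¹)) Φ)`. [cite: Kudla1984, §1] -/
theorem thetaKernelDatum_thetaFun_blockDiag_seesawTensor [LocallyCompactSpace (adelic F E c N JV)]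
    [LocallyCompactSpace (adelic F E c (M₁ + M₂) (finSum M₁ M₂ J₁ J₂))]
    (hρ : HasThetaMajorants fun (p : adelic F E c N JV × adelic F E c (M₁ + M₂) (finSum M₁ M₂ J₁ J₂))
      (Φ : piSchwartzBruhat F (Fin n)) => pairRep F E c N (M₁ + M₂) eW JV (finSum M₁ M₂ J₁ J₂) s p Φ)
    (SK : Set (piSchwartzBruhat F (Fin n)))
    (hSK : ∀ (h : adelic F E c (M₁ + M₂) (finSum M₁ M₂ J₁ J₂)) (Φ : piSchwartzBruhat F (Fin n)), Φ ∈ SK →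
      pairRep F E c N (M₁ + M₂) eW JV (finSum M₁ M₂ J₁ J₂) s (1, h) Φ ∈ SK)
    (x : adelic F E c N JV) (u₁ : adelic F E c M₁ J₁) (u₂ : adelic F E c M₂ J₂)
    (Φ₁ : piSchwartzBruhat F (Fin N × Fin M₁)) (Φ₂ : piSchwartzBruhat F (Fin N × Fin M₂)) :
    (thetaKernelDatum F E c N (M₁ + M₂) eW JV (finSum M₁ M₂ J₁ J₂) hcδ hδ hd hV (isSymm_finSum h₁ h₂) hVd hWd hJV
        (finSum_eq_map_finSum F E M₁ M₂ J₁ J₂ hJ₁ hJ₂) s hs hρ SK hSK).thetaFun (seesawTensor F N M₁ M₂ eW Φ₁ Φ₂)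
        (x, adelicBlockDiag F E c M₁ M₂ J₁ J₂ (u₁, u₂)) =
      thetaDistLM F (Fin N × Fin M₁)
          (seesawRep₁ F E c N M₁ M₂ eW e₁ e₂ JV J₁ J₂ hcδ hδ hd hV h₁ h₂ hVd h₁d h₂d hWd hJV hJ₁ hJ₂ hs hs₁ hs₂
            (x⁻¹, u₁⁻¹) Φ₁) *
        thetaDistLM F (Fin N × Fin M₂)
          (seesawRep₂ F E c N M₁ M₂ eW e₁ e₂ JV J₁ J₂ hcδ hδ hd hV h₁ h₂ hVd h₁d h₂d hWd hJV hJ₁ hJ₂ hs hs₁ hs₂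
            (x⁻¹, u₂⁻¹) Φ₂) :=
  ((thetaKernelDatum F E c N (M₁ + M₂) eW JV (finSum M₁ M₂ J₁ J₂) hcδ hδ hd hV (isSymm_finSum h₁ h₂) hVd hWd hJV
        (finSum_eq_map_finSum F E M₁ M₂ J₁ J₂ hJ₁ hJ₂) s hs hρ SK hSK).thetaFun_apply (seesawTensor F N M₁ M₂ eW Φ₁ Φ₂)
        (x, adelicBlockDiag F E c M₁ M₂ J₁ J₂ (u₁, u₂))).trans
    ((congrArg (fun p : adelic F E c N JV × adelic F E c (M₁ + M₂) (finSum M₁ M₂ J₁ J₂) =>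
        thetaDistLM F (Fin n) (pairRep F E c N (M₁ + M₂) eW JV (finSum M₁ M₂ J₁ J₂) s p (seesawTensor F N M₁ M₂ eW Φ₁ Φ₂)))
        (prod_blockDiag_inv F E c N M₁ M₂ JV J₁ J₂ x u₁ u₂)).trans
      (thetaDistLM_pairRep_blockDiag_seesawTensor F E c N M₁ M₂ eW e₁ e₂ JV J₁ J₂ hcδ hδ hd hV h₁ h₂ hVd h₁d h₂d hWd
        hJV hJ₁ hJ₂ hs hs₁ hs₂ x⁻¹ u₁⁻¹ u₂⁻¹ Φ₁ Φ₂))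

/-- **… and for the WEDGE test function**: `θ_{φ₁₁ ⊗ φ₂₂ − φ₁₂ ⊗ φ₂₁}(x, u₁ ⊕ᶠ u₂) = θ′_{φ₁₁} θ′_{φ₂₂} − θ′_{φ₁₂} θ′_{φ₂₁}`
at `(x, u₁)`, `(x, u₂)`. [cite: Kudla1984, §1] -/
theorem thetaKernelDatum_thetaFun_blockDiag_seesawWedge [LocallyCompactSpace (adelic F E c N JV)]
    [LocallyCompactSpace (adelic F E c (M₁ + M₂) (finSum M₁ M₂ J₁ J₂))]
    (hρ : HasThetaMajorants fun (p : adelic F E c N JV × adelic F E c (M₁ + M₂) (finSum M₁ M₂ J₁ J₂))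
      (Φ : piSchwartzBruhat F (Fin n)) => pairRep F E c N (M₁ + M₂) eW JV (finSum M₁ M₂ J₁ J₂) s p Φ)
    (SK : Set (piSchwartzBruhat F (Fin n)))
    (hSK : ∀ (h : adelic F E c (M₁ + M₂) (finSum M₁ M₂ J₁ J₂)) (Φ : piSchwartzBruhat F (Fin n)), Φ ∈ SK →
      pairRep F E c N (M₁ + M₂) eW JV (finSum M₁ M₂ J₁ J₂) s (1, h) Φ ∈ SK)
    (x : adelic F E c N JV) (u₁ : adelic F E c M₁ J₁) (u₂ : adelic F E c M₂ J₂)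
    (φ₁₁ φ₁₂ : piSchwartzBruhat F (Fin N × Fin M₁)) (φ₂₁ φ₂₂ : piSchwartzBruhat F (Fin N × Fin M₂)) :
    (thetaKernelDatum F E c N (M₁ + M₂) eW JV (finSum M₁ M₂ J₁ J₂) hcδ hδ hd hV (isSymm_finSum h₁ h₂) hVd hWd hJV
        (finSum_eq_map_finSum F E M₁ M₂ J₁ J₂ hJ₁ hJ₂) s hs hρ SK hSK).thetaFun
        (seesawWedge F N M₁ M₂ eW φ₁₁ φ₁₂ φ₂₁ φ₂₂) (x, adelicBlockDiag F E c M₁ M₂ J₁ J₂ (u₁, u₂)) =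
      thetaDistLM F (Fin N × Fin M₁)
            (seesawRep₁ F E c N M₁ M₂ eW e₁ e₂ JV J₁ J₂ hcδ hδ hd hV h₁ h₂ hVd h₁d h₂d hWd hJV hJ₁ hJ₂ hs hs₁ hs₂
              (x⁻¹, u₁⁻¹) φ₁₁) *
          thetaDistLM F (Fin N × Fin M₂)
            (seesawRep₂ F E c N M₁ M₂ eW e₁ e₂ JV J₁ J₂ hcδ hδ hd hV h₁ h₂ hVd h₁d h₂d hWd hJV hJ₁ hJ₂ hs hs₁ hs₂
              (x⁻¹, u₂⁻¹) φ₂₂) -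
        thetaDistLM F (Fin N × Fin M₁)
            (seesawRep₁ F E c N M₁ M₂ eW e₁ e₂ JV J₁ J₂ hcδ hδ hd hV h₁ h₂ hVd h₁d h₂d hWd hJV hJ₁ hJ₂ hs hs₁ hs₂
              (x⁻¹, u₁⁻¹) φ₁₂) *
          thetaDistLM F (Fin N × Fin M₂)
            (seesawRep₂ F E c N M₁ M₂ eW e₁ e₂ JV J₁ J₂ hcδ hδ hd hV h₁ h₂ hVd h₁d h₂d hWd hJV hJ₁ hJ₂ hs hs₁ hs₂
              (x⁻¹, u₂⁻¹) φ₂₁) :=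
  ((thetaKernelDatum F E c N (M₁ + M₂) eW JV (finSum M₁ M₂ J₁ J₂) hcδ hδ hd hV (isSymm_finSum h₁ h₂) hVd hWd hJV
        (finSum_eq_map_finSum F E M₁ M₂ J₁ J₂ hJ₁ hJ₂) s hs hρ SK hSK).thetaFun_apply
        (seesawWedge F N M₁ M₂ eW φ₁₁ φ₁₂ φ₂₁ φ₂₂) (x, adelicBlockDiag F E c M₁ M₂ J₁ J₂ (u₁, u₂))).trans
    ((congrArg (fun p : adelic F E c N JV × adelic F E c (M₁ + M₂) (finSum M₁ M₂ J₁ J₂) =>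
        thetaDistLM F (Fin n) (pairRep F E c N (M₁ + M₂) eW JV (finSum M₁ M₂ J₁ J₂) s p
          (seesawWedge F N M₁ M₂ eW φ₁₁ φ₁₂ φ₂₁ φ₂₂)))
        (prod_blockDiag_inv F E c N M₁ M₂ JV J₁ J₂ x u₁ u₂)).trans
      (thetaDistLM_pairRep_blockDiag_seesawWedge F E c N M₁ M₂ eW e₁ e₂ JV J₁ J₂ hcδ hδ hd hV h₁ h₂ hVd h₁d h₂d hWd
        hJV hJ₁ hJ₂ hs hs₁ hs₂ x⁻¹ u₁⁻¹ u₂⁻¹ φ₁₁ φ₁₂ φ₂₁ φ₂₂))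

end Twelve

/-! ## §2 The conjugated `(34)` torus at the splitting data of record -/

section ThirtyFour

variable (F E : Type) [Field F] [NumberField F] [Field E] [NumberField E] [Algebra F E]
variable (c : E ≃ₐ[F] E) (N M₁ M₂ : ℕ) {n n₁ n₂ : ℕ} (eW : Fin N × Fin (M₁ + M₂) ≃ Fin n)
  (e₁ : Fin N × Fin M₁ ≃ Fin n₁) (e₂ : Fin N × Fin M₂ ≃ Fin n₂)
variable (JV : Matrix (Fin N) (Fin N) E) (JW : Matrix (Fin (M₁ + M₂)) (Fin (M₁ + M₂)) E)
  (J₁ : Matrix (Fin M₁) (Fin M₁) E) (J₂ : Matrix (Fin M₂) (Fin M₂) E)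
variable {TV : Matrix (Fin N) (Fin N) F} {TW : Matrix (Fin (M₁ + M₂)) (Fin (M₁ + M₂)) F}
  {T₁ : Matrix (Fin M₁) (Fin M₁) F} {T₂ : Matrix (Fin M₂) (Fin M₂) F}
variable [Algebra.IsQuadraticExtension F E] {δ : E} (hcδ : c δ = -δ) (hδ : δ ≠ 0) {d : F}
  (hd : δ * δ = algebraMap F E d) (hV : TV.IsSymm) (hW : TW.IsSymm) (h₁ : T₁.IsSymm) (h₂ : T₂.IsSymm)
  (hVd : IsUnit TV.det) (hTWd : IsUnit TW.det) (h₁d : IsUnit T₁.det) (h₂d : IsUnit T₂.det)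
  (hT : IsUnit (TV.map (algebraMap F (AdeleRing (𝓞 F) F)) ⊗ₖ TW.map (algebraMap F (AdeleRing (𝓞 F) F))).det)
  (hJV : JV = TV.map (algebraMap F E)) (hJW : JW = TW.map (algebraMap F E))
  (hJ₁ : J₁ = T₁.map (algebraMap F E)) (hJ₂ : J₂ = T₂.map (algebraMap F E))
  {s : adelicPair F E c N (M₁ + M₂) JV JW →* adelicMpCont F (Fin n) (adelicGram F eW TV TW)}
  {s₁ : adelicPair F E c N M₁ JV J₁ →* adelicMpCont F (Fin n₁) (adelicGram F e₁ TV T₁)}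
  {s₂ : adelicPair F E c N M₂ JV J₂ →* adelicMpCont F (Fin n₂) (adelicGram F e₂ TV T₂)}
  {g : GL (Fin (M₁ + M₂)) (AdeleRing (𝓞 E) E)} {g₀ : GL (Fin (M₁ + M₂)) E}
  (hgg₀ : (g : Matrix (Fin (M₁ + M₂)) (Fin (M₁ + M₂)) (AdeleRing (𝓞 E) E)) =
    ((g₀ : GL (Fin (M₁ + M₂)) E) : Matrix (Fin (M₁ + M₂)) (Fin (M₁ + M₂)) E).map (algebraMap E (AdeleRing (𝓞 E) E)))
  (hg : ((g : Matrix (Fin (M₁ + M₂)) (Fin (M₁ + M₂)) (AdeleRing (𝓞 E) E)).map (conjAdele F E c))ᵀ *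
      adelicForm E (M₁ + M₂) JW * g = adelicForm E (M₁ + M₂) (finSum M₁ M₂ J₁ J₂))
  {C : GL (Fin N × Fin (M₁ + M₂)) (AdeleRing (𝓞 F) F)} {C₀ : GL (Fin N × Fin (M₁ + M₂)) F}
  (hCC₀ : (C : Matrix (Fin N × Fin (M₁ + M₂)) (Fin N × Fin (M₁ + M₂)) (AdeleRing (𝓞 F) F)) =
    ((C₀ : GL (Fin N × Fin (M₁ + M₂)) F) : Matrix (Fin N × Fin (M₁ + M₂)) (Fin N × Fin (M₁ + M₂)) F).map
      (algebraMap F (AdeleRing (𝓞 F) F)))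
  (hC : TV.map (algebraMap F (AdeleRing (𝓞 F) F)) ⊗ₖ TW.map (algebraMap F (AdeleRing (𝓞 F) F)) *
      (C : Matrix (Fin N × Fin (M₁ + M₂)) (Fin N × Fin (M₁ + M₂)) (AdeleRing (𝓞 F) F)) =
    TV.map (algebraMap F (AdeleRing (𝓞 F) F)) ⊗ₖ (finSum M₁ M₂ T₁ T₂).map (algebraMap F (AdeleRing (𝓞 F) F)))

/-- **the pure tensor `Φ₁ ⊗ Φ₂` read in the big pair `(U(J_V), U(J_W))`'s Schrödinger model of record through the
see-saw element**: `R_{e_W} (ω(r_F h₀) (R_f⁻¹ (Φ₁ ⊠ Φ₂)))` (bilinear). [folklore] -/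
def seesawConjTensor :
    piSchwartzBruhat F (Fin N × Fin M₁) →ₗ[ℂ] piSchwartzBruhat F (Fin N × Fin M₂) →ₗ[ℂ] piSchwartzBruhat F (Fin n) :=
  (tensorToSum F (Fin N × Fin M₁) (Fin N × Fin M₂)).compr₂
    ((piSBReindex F eW).toLinearMap ∘ₗ
      (adelicMpCont.omega F (Fin N × Fin (M₁ + M₂))
          (TV.map (algebraMap F (AdeleRing (𝓞 F) F)) ⊗ₖ TW.map (algebraMap F (AdeleRing (𝓞 F) F)))
          (ratPointsThetaLiftCont F (Fin N × Fin (M₁ + M₂)) _ hT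
          ⟨seesawElement F E c N M₁ M₂ JV JW J₁ J₂ hcδ hδ hd hV hW h₁ h₂ hJV hJW hJ₁ hJ₂ hg hC,
            seesawElement_mem_range F E c N M₁ M₂ JV JW J₁ J₂ hcδ hδ hd hV hW h₁ h₂ hVd hTWd hT hJV hJW hJ₁ hJ₂ hgg₀
              hg hCC₀ hC⟩) ∘ₗ
        ((piSBReindex F (finProdSumEquiv N M₁ M₂)).symm).toLinearMap))

/-- Unfolding: `seesawConjTensor Φ₁ Φ₂ = R_{e_W} (ω(r_F h₀) (R_f⁻¹ (Φ₁ ⊠ Φ₂)))`. [folklore] -/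
theorem seesawConjTensor_apply (Φ₁ : piSchwartzBruhat F (Fin N × Fin M₁)) (Φ₂ : piSchwartzBruhat F (Fin N × Fin M₂)) :
    seesawConjTensor F E c N M₁ M₂ eW JV JW J₁ J₂ hcδ hδ hd hV hW h₁ h₂ hVd hTWd hT hJV hJW hJ₁ hJ₂ hgg₀ hg hCC₀ hC Φ₁ Φ₂ =
      piSBReindex F eW
        (adelicMpCont.omega F (Fin N × Fin (M₁ + M₂))
          (TV.map (algebraMap F (AdeleRing (𝓞 F) F)) ⊗ₖ TW.map (algebraMap F (AdeleRing (𝓞 F) F)))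
          (ratPointsThetaLiftCont F (Fin N × Fin (M₁ + M₂)) _ hT
          ⟨seesawElement F E c N M₁ M₂ JV JW J₁ J₂ hcδ hδ hd hV hW h₁ h₂ hJV hJW hJ₁ hJ₂ hg hC,
            seesawElement_mem_range F E c N M₁ M₂ JV JW J₁ J₂ hcδ hδ hd hV hW h₁ h₂ hVd hTWd hT hJV hJW hJ₁ hJ₂ hgg₀
              hg hCC₀ hC⟩)
          ((piSBReindex F (finProdSumEquiv N M₁ M₂)).symm (tensorToSum F (Fin N × Fin M₁) (Fin N × Fin M₂) Φ₁ Φ₂))) :=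
  rfl

/-- **the conjugated WEDGE test function** `φ₁₁ ⊗ φ₂₂ − φ₁₂ ⊗ φ₂₁` read through the see-saw element. [folklore] -/
def seesawConjWedge (φ₁₁ φ₁₂ : piSchwartzBruhat F (Fin N × Fin M₁)) (φ₂₁ φ₂₂ : piSchwartzBruhat F (Fin N × Fin M₂)) :
    piSchwartzBruhat F (Fin n) :=
  seesawConjTensor F E c N M₁ M₂ eW JV JW J₁ J₂ hcδ hδ hd hV hW h₁ h₂ hVd hTWd hT hJV hJW hJ₁ hJ₂ hgg₀ hg hCC₀ hC φ₁₁ φ₂₂ - seesawConjTensor F E c N M₁ M₂ eW JV JW J₁ J₂ hcδ hδ hd hV hW h₁ h₂ hVd hTWd hT hJV hJW hJ₁ hJ₂ hgg₀ hg hCC₀ hC φ₁₂ φ₂₁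

/-- Unfolding. [folklore] -/
theorem seesawConjWedge_def (φ₁₁ φ₁₂ : piSchwartzBruhat F (Fin N × Fin M₁))
    (φ₂₁ φ₂₂ : piSchwartzBruhat F (Fin N × Fin M₂)) :
    seesawConjWedge F E c N M₁ M₂ eW JV JW J₁ J₂ hcδ hδ hd hV hW h₁ h₂ hVd hTWd hT hJV hJW hJ₁ hJ₂ hgg₀ hg hCC₀ hC φ₁₁ φ₁₂ φ₂₁ φ₂₂ =
      seesawConjTensor F E c N M₁ M₂ eW JV JW J₁ J₂ hcδ hδ hd hV hW h₁ h₂ hVd hTWd hT hJV hJW hJ₁ hJ₂ hgg₀ hg hCC₀ hC φ₁₁ φ₂₂ - seesawConjTensor F E c N M₁ M₂ eW JV JW J₁ J₂ hcδ hδ hd hV hW h₁ h₂ hVd hTWd hT hJV hJW hJ₁ hJ₂ hgg₀ hg hCC₀ hC φ₁₂ φ₂₁ :=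
  rfl

variable
  (hs : (splittingDatum F E c N (M₁ + M₂) eW JV JW hcδ hδ hd hV hW hVd hTWd hJV hJW).IsCompatible s)
  (hs₁ : (splittingDatum F E c N M₁ e₁ JV J₁ hcδ hδ hd hV h₁ hVd h₁d hJV hJ₁).IsCompatible s₁)
  (hs₂ : (splittingDatum F E c N M₂ e₂ JV J₂ hcδ hδ hd hV h₂ hVd h₂d hJV hJ₂).IsCompatible s₂)

/-- **`λ₃ : U(J₁)(𝔸) →* ℂˣ`, `u₁ ↦ χ₃₄(1,(u₁,1))`** — the first small factor of the see-saw character of the CONJUGATED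
torus. [folklore] -/
def char₃ : adelic F E c M₁ J₁ →* ℂˣ :=
  mpChar₁ (seesawConjSum F E c N M₁ M₂ eW JV JW J₁ J₂ hcδ hδ hd hV hW h₁ h₂ hVd hTWd hT hJV hJW hJ₁ hJ₂ hgg₀ hg hCC₀ hC (s := s)) (pairSmall₁ F E c N M₁ e₁ JV J₁ s₁) (pairSmall₂ F E c N M₂ e₂ JV J₂ s₂)
    (hs₃_seesawConj F E c N M₁ M₂ eW e₁ e₂ JV JW J₁ J₂ hcδ hδ hd hV hW h₁ h₂ hVd hTWd h₁d h₂d hT hJV hJW hJ₁ hJ₂ hgg₀ hg hCC₀ hC hs hs₁ hs₂) (isUnit_kronecker_map F N hVd h₁d) (isUnit_kronecker_map F N hVd h₂d)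

/-- **`λ₄ : U(J₂)(𝔸) →* ℂˣ`, `u₂ ↦ χ₃₄(1,(1,u₂))`** — the second small factor. [folklore] -/
def char₄ : adelic F E c M₂ J₂ →* ℂˣ :=
  mpChar₂ (seesawConjSum F E c N M₁ M₂ eW JV JW J₁ J₂ hcδ hδ hd hV hW h₁ h₂ hVd hTWd hT hJV hJW hJ₁ hJ₂ hgg₀ hg hCC₀ hC (s := s)) (pairSmall₁ F E c N M₁ e₁ JV J₁ s₁) (pairSmall₂ F E c N M₂ e₂ JV J₂ s₂)
    (hs₃_seesawConj F E c N M₁ M₂ eW e₁ e₂ JV JW J₁ J₂ hcδ hδ hd hV hW h₁ h₂ hVd hTWd h₁d h₂d hT hJV hJW hJ₁ hJ₂ hgg₀ hg hCC₀ hC hs hs₁ hs₂) (isUnit_kronecker_map F N hVd h₁d) (isUnit_kronecker_map F N hVd h₂d)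

/-- **`ω₁″` — the renormalised Weil representation of the first small pair for the CONJUGATED torus** on
`U(J_V)(𝔸) × U(J₁)(𝔸)` (`ω ∘ pairSmall₁ s₁` twisted by `(v,u₁) ↦ λ_V′ v · λ₃ u₁`). (cf. R. Howe (1979) §3) [folklore] -/
def seesawConjRep₁ :
    Representation ℂ (adelic F E c N JV × adelic F E c M₁ J₁) (piSchwartzBruhat F (Fin N × Fin M₁)) :=
  SeesawScalar.twist
    (mpCharSmall₁ (seesawConjSum F E c N M₁ M₂ eW JV JW J₁ J₂ hcδ hδ hd hV hW h₁ h₂ hVd hTWd hT hJV hJW hJ₁ hJ₂ hgg₀ hg hCC₀ hC (s := s)) (pairSmall₁ F E c N M₁ e₁ JV J₁ s₁)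
      (pairSmall₂ F E c N M₂ e₂ JV J₂ s₂) (hs₃_seesawConj F E c N M₁ M₂ eW e₁ e₂ JV JW J₁ J₂ hcδ hδ hd hV hW h₁ h₂ hVd hTWd h₁d h₂d hT hJV hJW hJ₁ hJ₂ hgg₀ hg hCC₀ hC hs hs₁ hs₂)
      (isUnit_kronecker_map F N hVd h₁d) (isUnit_kronecker_map F N hVd h₂d))
    ((adelicMpCont.omega F (Fin N × Fin M₁)
              (TV.map (algebraMap F (AdeleRing (𝓞 F) F)) ⊗ₖ T₁.map (algebraMap F (AdeleRing (𝓞 F) F)))).comp (pairSmall₁ F E c N M₁ e₁ JV J₁ s₁))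

/-- **`ω₂″` — the renormalised Weil representation of the second small pair for the CONJUGATED torus**
(`ω ∘ pairSmall₂ s₂` twisted by `(v,u₂) ↦ λ₄ u₂`). (cf. R. Howe (1979) §3) [folklore] -/
def seesawConjRep₂ :
    Representation ℂ (adelic F E c N JV × adelic F E c M₂ J₂) (piSchwartzBruhat F (Fin N × Fin M₂)) :=
  SeesawScalar.twist
    (mpCharSmall₂ (seesawConjSum F E c N M₁ M₂ eW JV JW J₁ J₂ hcδ hδ hd hV hW h₁ h₂ hVd hTWd hT hJV hJW hJ₁ hJ₂ hgg₀ hg hCC₀ hC (s := s)) (pairSmall₁ F E c N M₁ e₁ JV J₁ s₁)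
      (pairSmall₂ F E c N M₂ e₂ JV J₂ s₂) (hs₃_seesawConj F E c N M₁ M₂ eW e₁ e₂ JV JW J₁ J₂ hcδ hδ hd hV hW h₁ h₂ hVd hTWd h₁d h₂d hT hJV hJW hJ₁ hJ₂ hgg₀ hg hCC₀ hC hs hs₁ hs₂)
      (isUnit_kronecker_map F N hVd h₁d) (isUnit_kronecker_map F N hVd h₂d))
    ((adelicMpCont.omega F (Fin N × Fin M₂)
              (TV.map (algebraMap F (AdeleRing (𝓞 F) F)) ⊗ₖ T₂.map (algebraMap F (AdeleRing (𝓞 F) F)))).comp (pairSmall₂ F E c N M₂ e₂ JV J₂ s₂))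

/-- `ω₁″(v,u₁) Φ₁ = (λ_V′ v · λ₃ u₁) • ω(pairSmall₁ s₁ (v,u₁)) Φ₁`. [folklore] -/
theorem seesawConjRep₁_apply (v : adelic F E c N JV) (u₁ : adelic F E c M₁ J₁)
    (Φ₁ : piSchwartzBruhat F (Fin N × Fin M₁)) :
    seesawConjRep₁ F E c N M₁ M₂ eW e₁ e₂ JV JW J₁ J₂ hcδ hδ hd hV hW h₁ h₂ hVd hTWd h₁d h₂d hT hJV hJW hJ₁ hJ₂ hgg₀ hg hCC₀ hC hs hs₁ hs₂ (v, u₁) Φ₁ =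
      ((charV₃₄ F E c N M₁ M₂ eW e₁ e₂ JV JW J₁ J₂ hcδ hδ hd hV hW h₁ h₂ hVd hTWd h₁d h₂d hT hJV hJW hJ₁ hJ₂ hgg₀ hg hCC₀ hC hs hs₁ hs₂ v * char₃ F E c N M₁ M₂ eW e₁ e₂ JV JW J₁ J₂ hcδ hδ hd hV hW h₁ h₂ hVd hTWd h₁d h₂d hT hJV hJW hJ₁ hJ₂ hgg₀ hg hCC₀ hC hs hs₁ hs₂ u₁ : ℂˣ) : ℂ) • (adelicMpCont.omega F (Fin N × Fin M₁)
              (TV.map (algebraMap F (AdeleRing (𝓞 F) F)) ⊗ₖ T₁.map (algebraMap F (AdeleRing (𝓞 F) F)))) (pairSmall₁ F E c N M₁ e₁ JV J₁ s₁ (v, u₁)) Φ₁ :=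
  (SeesawScalar.twist_apply _ _ (v, u₁) Φ₁).trans
    (congrArg (fun χ : ℂˣ => (χ : ℂ) • (adelicMpCont.omega F (Fin N × Fin M₁)
              (TV.map (algebraMap F (AdeleRing (𝓞 F) F)) ⊗ₖ T₁.map (algebraMap F (AdeleRing (𝓞 F) F)))) (pairSmall₁ F E c N M₁ e₁ JV J₁ s₁ (v, u₁)) Φ₁)
      (mpCharSmall₁_apply_eq_mul _ _ _ _ _ _ v u₁))

/-- `ω₂″(v,u₂) Φ₂ = λ₄ u₂ • ω(pairSmall₂ s₂ (v,u₂)) Φ₂`. [folklore] -/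
theorem seesawConjRep₂_apply (v : adelic F E c N JV) (u₂ : adelic F E c M₂ J₂)
    (Φ₂ : piSchwartzBruhat F (Fin N × Fin M₂)) :
    seesawConjRep₂ F E c N M₁ M₂ eW e₁ e₂ JV JW J₁ J₂ hcδ hδ hd hV hW h₁ h₂ hVd hTWd h₁d h₂d hT hJV hJW hJ₁ hJ₂ hgg₀ hg hCC₀ hC hs hs₁ hs₂ (v, u₂) Φ₂ =
      ((char₄ F E c N M₁ M₂ eW e₁ e₂ JV JW J₁ J₂ hcδ hδ hd hV hW h₁ h₂ hVd hTWd h₁d h₂d hT hJV hJW hJ₁ hJ₂ hgg₀ hg hCC₀ hC hs hs₁ hs₂ u₂ : ℂˣ) : ℂ) • (adelicMpCont.omega F (Fin N × Fin M₂)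
              (TV.map (algebraMap F (AdeleRing (𝓞 F) F)) ⊗ₖ T₂.map (algebraMap F (AdeleRing (𝓞 F) F)))) (pairSmall₂ F E c N M₂ e₂ JV J₂ s₂ (v, u₂)) Φ₂ :=
  SeesawScalar.twist_apply _ _ (v, u₂) Φ₂

/-- **`λ₃ = 1` on `U(J₁)(F)`** (`g` rational). [cite: Weil1964, Chap. III n° 41 Thm 6 p. 193] -/
theorem char₃_eq_one_of_rational
    (hg₀ : (((g₀ : GL (Fin (M₁ + M₂)) E) : Matrix (Fin (M₁ + M₂)) (Fin (M₁ + M₂)) E).map (c : E →+* E))ᵀ * JW * g₀ =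
      finSum M₁ M₂ J₁ J₂)
    {u₁ : adelic F E c M₁ J₁} (hu₁ : u₁ ∈ (toAdelic F E c M₁ J₁).range) :
    char₃ F E c N M₁ M₂ eW e₁ e₂ JV JW J₁ J₂ hcδ hδ hd hV hW h₁ h₂ hVd hTWd h₁d h₂d hT hJV hJW hJ₁ hJ₂ hgg₀ hg hCC₀ hC hs hs₁ hs₂ u₁ = 1 :=
  mpChar₁_eq_one_of_mem_adelicMpTheta _ _ _ (hs₃_seesawConj F E c N M₁ M₂ eW e₁ e₂ JV JW J₁ J₂ hcδ hδ hd hV hW h₁ h₂ hVd hTWd h₁d h₂d hT hJV hJW hJ₁ hJ₂ hgg₀ hg hCC₀ hC hs hs₁ hs₂) _ _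
    (coe_seesawConjSum_mem_adelicMpTheta F E c N M₁ M₂ eW JV JW J₁ J₂ hcδ hδ hd hV hW h₁ h₂ hVd hTWd hT hJV hJW hJ₁ hJ₂ hgg₀ hg hCC₀ hC hs hg₀ (one_mem _) hu₁ (one_mem _))
    (coe_pairSmall₁_mem_adelicMpTheta F E c N M₁ e₁ JV J₁ hcδ hδ hd hV h₁ hVd h₁d hJV hJ₁ hs₁ (one_mem _) hu₁)

/-- **`λ₄ = 1` on `U(J₂)(F)`** (`g` rational). [cite: Weil1964, Chap. III n° 41 Thm 6 p. 193] -/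
theorem char₄_eq_one_of_rational
    (hg₀ : (((g₀ : GL (Fin (M₁ + M₂)) E) : Matrix (Fin (M₁ + M₂)) (Fin (M₁ + M₂)) E).map (c : E →+* E))ᵀ * JW * g₀ =
      finSum M₁ M₂ J₁ J₂)
    {u₂ : adelic F E c M₂ J₂} (hu₂ : u₂ ∈ (toAdelic F E c M₂ J₂).range) :
    char₄ F E c N M₁ M₂ eW e₁ e₂ JV JW J₁ J₂ hcδ hδ hd hV hW h₁ h₂ hVd hTWd h₁d h₂d hT hJV hJW hJ₁ hJ₂ hgg₀ hg hCC₀ hC hs hs₁ hs₂ u₂ = 1 :=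
  mpChar₂_eq_one_of_mem_adelicMpTheta _ _ _ (hs₃_seesawConj F E c N M₁ M₂ eW e₁ e₂ JV JW J₁ J₂ hcδ hδ hd hV hW h₁ h₂ hVd hTWd h₁d h₂d hT hJV hJW hJ₁ hJ₂ hgg₀ hg hCC₀ hC hs hs₁ hs₂) _ _
    (coe_seesawConjSum_mem_adelicMpTheta F E c N M₁ M₂ eW JV JW J₁ J₂ hcδ hδ hd hV hW h₁ h₂ hVd hTWd hT hJV hJW hJ₁ hJ₂ hgg₀ hg hCC₀ hC hs hg₀ (one_mem _) (one_mem _) hu₂)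
    (coe_pairSmall₂_mem_adelicMpTheta F E c N M₂ e₂ JV J₂ hcδ hδ hd hV h₂ hVd h₂d hJV hJ₂ hs₂ (one_mem _) hu₂)

/-- **See-saw of theta kernels in block-sum coordinates, conjugated torus**:
`Θ(ω(seesawConjSum (v,(u₁,u₂))) (Φ₁ ⊠ Φ₂)) = Θ(ω₁″(v,u₁) Φ₁) · Θ(ω₂″(v,u₂) Φ₂)`. [cite: Kudla1984, §1] -/
theorem thetaDistLM_omega_seesawConjSum_tensorToSum (v : adelic F E c N JV) (u₁ : adelic F E c M₁ J₁)
    (u₂ : adelic F E c M₂ J₂) (Φ₁ : piSchwartzBruhat F (Fin N × Fin M₁)) (Φ₂ : piSchwartzBruhat F (Fin N × Fin M₂)) :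
    thetaDistLM F ((Fin N × Fin M₁) ⊕ (Fin N × Fin M₂))
        (adelicMpCont.omega F ((Fin N × Fin M₁) ⊕ (Fin N × Fin M₂))
          (Matrix.fromBlocks (TV.map (algebraMap F (AdeleRing (𝓞 F) F)) ⊗ₖ T₁.map (algebraMap F (AdeleRing (𝓞 F) F))) 0 0
            (TV.map (algebraMap F (AdeleRing (𝓞 F) F)) ⊗ₖ T₂.map (algebraMap F (AdeleRing (𝓞 F) F))))
          (seesawConjSum F E c N M₁ M₂ eW JV JW J₁ J₂ hcδ hδ hd hV hW h₁ h₂ hVd hTWd hT hJV hJW hJ₁ hJ₂ hgg₀ hg hCC₀ hC (s := s) (v, (u₁, u₂)))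
          (tensorToSum F (Fin N × Fin M₁) (Fin N × Fin M₂) Φ₁ Φ₂)) =
      thetaDistLM F (Fin N × Fin M₁) (seesawConjRep₁ F E c N M₁ M₂ eW e₁ e₂ JV JW J₁ J₂ hcδ hδ hd hV hW h₁ h₂ hVd hTWd h₁d h₂d hT hJV hJW hJ₁ hJ₂ hgg₀ hg hCC₀ hC hs hs₁ hs₂ (v, u₁) Φ₁) *
        thetaDistLM F (Fin N × Fin M₂) (seesawConjRep₂ F E c N M₁ M₂ eW e₁ e₂ JV JW J₁ J₂ hcδ hδ hd hV hW h₁ h₂ hVd hTWd h₁d h₂d hT hJV hJW hJ₁ hJ₂ hgg₀ hg hCC₀ hC hs hs₁ hs₂ (v, u₂) Φ₂) :=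
  thetaDistLM_mpSeesaw_tensorToSum _ _ _ (hs₃_seesawConj F E c N M₁ M₂ eW e₁ e₂ JV JW J₁ J₂ hcδ hδ hd hV hW h₁ h₂ hVd hTWd h₁d h₂d hT hJV hJW hJ₁ hJ₂ hgg₀ hg hCC₀ hC hs hs₁ hs₂) _ _ v u₁ u₂ Φ₁ Φ₂

/-- **THE SEE-SAW IDENTITY OF THETA KERNELS AT THE DATA OF RECORD, CONJUGATED `(34)` torus**: for all
`v, u₁, u₂, Φ₁, Φ₂`, `Θ(ω_ψ(s_pair(v, g (u₁ ⊕ᶠ u₂) g⁻¹)) (R_{e_W} ω(r_F h₀) R_f⁻¹ (Φ₁ ⊠ Φ₂))) = Θ(ω₁″(v,u₁) Φ₁) · Θ(ω₂″(v,u₂) Φ₂)`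
— the theta kernel of the big pair `(U(J_V), U(J_W))` restricted to the conjugated torus `U(J_V) × g (U(J₁) × U(J₂)) g⁻¹`
is the product of the two renormalised small kernels. [cite: Kudla1984, §1] -/
theorem thetaDistLM_pairRep_isometryConj_seesawConjTensor (v : adelic F E c N JV) (u₁ : adelic F E c M₁ J₁)
    (u₂ : adelic F E c M₂ J₂) (Φ₁ : piSchwartzBruhat F (Fin N × Fin M₁)) (Φ₂ : piSchwartzBruhat F (Fin N × Fin M₂)) :
    thetaDistLM F (Fin n)
        (adelicMpCont.omega F (Fin n) (adelicGram F eW TV TW)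
          (pairSplitting F E c N (M₁ + M₂) eW JV JW s
            (v, adelicIsometryConj F E c (M₁ + M₂) g hg (adelicBlockDiag F E c M₁ M₂ J₁ J₂ (u₁, u₂))))
          (seesawConjTensor F E c N M₁ M₂ eW JV JW J₁ J₂ hcδ hδ hd hV hW h₁ h₂ hVd hTWd hT hJV hJW hJ₁ hJ₂ hgg₀ hg hCC₀ hC Φ₁ Φ₂)) =
      thetaDistLM F (Fin N × Fin M₁) (seesawConjRep₁ F E c N M₁ M₂ eW e₁ e₂ JV JW J₁ J₂ hcδ hδ hd hV hW h₁ h₂ hVd hTWd h₁d h₂d hT hJV hJW hJ₁ hJ₂ hgg₀ hg hCC₀ hC hs hs₁ hs₂ (v, u₁) Φ₁) *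
        thetaDistLM F (Fin N × Fin M₂) (seesawConjRep₂ F E c N M₁ M₂ eW e₁ e₂ JV JW J₁ J₂ hcδ hδ hd hV hW h₁ h₂ hVd hTWd h₁d h₂d hT hJV hJW hJ₁ hJ₂ hgg₀ hg hCC₀ hC hs hs₁ hs₂ (v, u₂) Φ₂) :=
  (thetaDistLM_omega_seesawConjSum F E c N M₁ M₂ eW JV JW J₁ J₂ hcδ hδ hd hV hW h₁ h₂ hVd hTWd hT hJV hJW hJ₁ hJ₂ hgg₀ hg hCC₀ hC (s := s) (v, (u₁, u₂))
      (tensorToSum F (Fin N × Fin M₁) (Fin N × Fin M₂) Φ₁ Φ₂)).symm.trans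
    (thetaDistLM_omega_seesawConjSum_tensorToSum F E c N M₁ M₂ eW e₁ e₂ JV JW J₁ J₂ hcδ hδ hd hV hW h₁ h₂ hVd hTWd h₁d h₂d hT hJV hJW hJ₁ hJ₂ hgg₀ hg hCC₀ hC hs hs₁ hs₂ v u₁ u₂ Φ₁ Φ₂)

/-- **… with the see-saw character explicit**: `= (λ_V′ v · λ₃ u₁ · λ₄ u₂) · Θ(ω(pairSmall₁ s₁ (v,u₁)) Φ₁) ·
Θ(ω(pairSmall₂ s₂ (v,u₂)) Φ₂)`. [cite: Howe1979, §3] -/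
theorem thetaDistLM_pairRep_isometryConj_seesawConjTensor_eq_char_mul (v : adelic F E c N JV)
    (u₁ : adelic F E c M₁ J₁) (u₂ : adelic F E c M₂ J₂) (Φ₁ : piSchwartzBruhat F (Fin N × Fin M₁))
    (Φ₂ : piSchwartzBruhat F (Fin N × Fin M₂)) :
    thetaDistLM F (Fin n)
        (adelicMpCont.omega F (Fin n) (adelicGram F eW TV TW)
          (pairSplitting F E c N (M₁ + M₂) eW JV JW s
            (v, adelicIsometryConj F E c (M₁ + M₂) g hg (adelicBlockDiag F E c M₁ M₂ J₁ J₂ (u₁, u₂))))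
          (seesawConjTensor F E c N M₁ M₂ eW JV JW J₁ J₂ hcδ hδ hd hV hW h₁ h₂ hVd hTWd hT hJV hJW hJ₁ hJ₂ hgg₀ hg hCC₀ hC Φ₁ Φ₂)) =
      ((charV₃₄ F E c N M₁ M₂ eW e₁ e₂ JV JW J₁ J₂ hcδ hδ hd hV hW h₁ h₂ hVd hTWd h₁d h₂d hT hJV hJW hJ₁ hJ₂ hgg₀ hg hCC₀ hC hs hs₁ hs₂ v * char₃ F E c N M₁ M₂ eW e₁ e₂ JV JW J₁ J₂ hcδ hδ hd hV hW h₁ h₂ hVd hTWd h₁d h₂d hT hJV hJW hJ₁ hJ₂ hgg₀ hg hCC₀ hC hs hs₁ hs₂ u₁ * char₄ F E c N M₁ M₂ eW e₁ e₂ JV JW J₁ J₂ hcδ hδ hd hV hW h₁ h₂ hVd hTWd h₁d h₂d hT hJV hJW hJ₁ hJ₂ hgg₀ hg hCC₀ hC hs hs₁ hs₂ u₂ : ℂˣ) : ℂ) *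
        (thetaDistLM F (Fin N × Fin M₁) ((adelicMpCont.omega F (Fin N × Fin M₁)
              (TV.map (algebraMap F (AdeleRing (𝓞 F) F)) ⊗ₖ T₁.map (algebraMap F (AdeleRing (𝓞 F) F)))) (pairSmall₁ F E c N M₁ e₁ JV J₁ s₁ (v, u₁)) Φ₁) *
          thetaDistLM F (Fin N × Fin M₂) ((adelicMpCont.omega F (Fin N × Fin M₂)
              (TV.map (algebraMap F (AdeleRing (𝓞 F) F)) ⊗ₖ T₂.map (algebraMap F (AdeleRing (𝓞 F) F)))) (pairSmall₂ F E c N M₂ e₂ JV J₂ s₂ (v, u₂)) Φ₂)) :=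
  (thetaDistLM_omega_seesawConjSum F E c N M₁ M₂ eW JV JW J₁ J₂ hcδ hδ hd hV hW h₁ h₂ hVd hTWd hT hJV hJW hJ₁ hJ₂ hgg₀ hg hCC₀ hC (s := s) (v, (u₁, u₂))
      (tensorToSum F (Fin N × Fin M₁) (Fin N × Fin M₂) Φ₁ Φ₂)).symm.trans
    ((thetaDistLM_mpSeesaw_tensorToSum_eq_char_mul _ _ _ (hs₃_seesawConj F E c N M₁ M₂ eW e₁ e₂ JV JW J₁ J₂ hcδ hδ hd hV hW h₁ h₂ hVd hTWd h₁d h₂d hT hJV hJW hJ₁ hJ₂ hgg₀ hg hCC₀ hC hs hs₁ hs₂) _ _ v u₁ u₂ Φ₁ Φ₂).trans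
      (congrArg (fun χ : ℂˣ => (χ : ℂ) *
          (thetaDistLM F (Fin N × Fin M₁) ((adelicMpCont.omega F (Fin N × Fin M₁)
              (TV.map (algebraMap F (AdeleRing (𝓞 F) F)) ⊗ₖ T₁.map (algebraMap F (AdeleRing (𝓞 F) F)))) (pairSmall₁ F E c N M₁ e₁ JV J₁ s₁ (v, u₁)) Φ₁) *
            thetaDistLM F (Fin N × Fin M₂) ((adelicMpCont.omega F (Fin N × Fin M₂)
              (TV.map (algebraMap F (AdeleRing (𝓞 F) F)) ⊗ₖ T₂.map (algebraMap F (AdeleRing (𝓞 F) F)))) (pairSmall₂ F E c N M₂ e₂ JV J₂ s₂ (v, u₂)) Φ₂)))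
        (mpSeesawChar₃_factor _ _ _ _ _ _ v u₁ u₂)))

/-- **The WEDGE form, conjugated torus**: `Θ(ω_ψ(s_pair(v, g (u₁ ⊕ᶠ u₂) g⁻¹)) (seesawConjWedge φ₁₁ φ₁₂ φ₂₁ φ₂₂)) =
Θ(ω₁″ φ₁₁) Θ(ω₂″ φ₂₂) − Θ(ω₁″ φ₁₂) Θ(ω₂″ φ₂₁)` at `(v,u₁)`, `(v,u₂)`. [cite: Kudla1984, §1] -/
theorem thetaDistLM_pairRep_isometryConj_seesawConjWedge (v : adelic F E c N JV) (u₁ : adelic F E c M₁ J₁)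
    (u₂ : adelic F E c M₂ J₂) (φ₁₁ φ₁₂ : piSchwartzBruhat F (Fin N × Fin M₁))
    (φ₂₁ φ₂₂ : piSchwartzBruhat F (Fin N × Fin M₂)) :
    thetaDistLM F (Fin n)
        (adelicMpCont.omega F (Fin n) (adelicGram F eW TV TW)
          (pairSplitting F E c N (M₁ + M₂) eW JV JW s
            (v, adelicIsometryConj F E c (M₁ + M₂) g hg (adelicBlockDiag F E c M₁ M₂ J₁ J₂ (u₁, u₂))))
          (seesawConjWedge F E c N M₁ M₂ eW JV JW J₁ J₂ hcδ hδ hd hV hW h₁ h₂ hVd hTWd hT hJV hJW hJ₁ hJ₂ hgg₀ hg hCC₀ hC φ₁₁ φ₁₂ φ₂₁ φ₂₂)) =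
      thetaDistLM F (Fin N × Fin M₁) (seesawConjRep₁ F E c N M₁ M₂ eW e₁ e₂ JV JW J₁ J₂ hcδ hδ hd hV hW h₁ h₂ hVd hTWd h₁d h₂d hT hJV hJW hJ₁ hJ₂ hgg₀ hg hCC₀ hC hs hs₁ hs₂ (v, u₁) φ₁₁) *
          thetaDistLM F (Fin N × Fin M₂) (seesawConjRep₂ F E c N M₁ M₂ eW e₁ e₂ JV JW J₁ J₂ hcδ hδ hd hV hW h₁ h₂ hVd hTWd h₁d h₂d hT hJV hJW hJ₁ hJ₂ hgg₀ hg hCC₀ hC hs hs₁ hs₂ (v, u₂) φ₂₂) -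
        thetaDistLM F (Fin N × Fin M₁) (seesawConjRep₁ F E c N M₁ M₂ eW e₁ e₂ JV JW J₁ J₂ hcδ hδ hd hV hW h₁ h₂ hVd hTWd h₁d h₂d hT hJV hJW hJ₁ hJ₂ hgg₀ hg hCC₀ hC hs hs₁ hs₂ (v, u₁) φ₁₂) *
          thetaDistLM F (Fin N × Fin M₂) (seesawConjRep₂ F E c N M₁ M₂ eW e₁ e₂ JV JW J₁ J₂ hcδ hδ hd hV hW h₁ h₂ hVd hTWd h₁d h₂d hT hJV hJW hJ₁ hJ₂ hgg₀ hg hCC₀ hC hs hs₁ hs₂ (v, u₂) φ₂₁) :=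
  (congrArg (thetaDistLM F (Fin n)) (map_sub (adelicMpCont.omega F (Fin n) (adelicGram F eW TV TW)
      (pairSplitting F E c N (M₁ + M₂) eW JV JW s
        (v, adelicIsometryConj F E c (M₁ + M₂) g hg (adelicBlockDiag F E c M₁ M₂ J₁ J₂ (u₁, u₂)))))
      (seesawConjTensor F E c N M₁ M₂ eW JV JW J₁ J₂ hcδ hδ hd hV hW h₁ h₂ hVd hTWd hT hJV hJW hJ₁ hJ₂ hgg₀ hg hCC₀ hC φ₁₁ φ₂₂) (seesawConjTensor F E c N M₁ M₂ eW JV JW J₁ J₂ hcδ hδ hd hV hW h₁ h₂ hVd hTWd hT hJV hJW hJ₁ hJ₂ hgg₀ hg hCC₀ hC φ₁₂ φ₂₁))).trans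
    ((map_sub (thetaDistLM F (Fin n)) _ _).trans
      (congrArg₂ (· - ·)
        (thetaDistLM_pairRep_isometryConj_seesawConjTensor F E c N M₁ M₂ eW e₁ e₂ JV JW J₁ J₂ hcδ hδ hd hV hW h₁ h₂ hVd hTWd h₁d h₂d hT hJV hJW hJ₁ hJ₂ hgg₀ hg hCC₀ hC hs hs₁ hs₂ v u₁ u₂ φ₁₁ φ₂₂)
        (thetaDistLM_pairRep_isometryConj_seesawConjTensor F E c N M₁ M₂ eW e₁ e₂ JV JW J₁ J₂ hcδ hδ hd hV hW h₁ h₂ hVd hTWd h₁d h₂d hT hJV hJW hJ₁ hJ₂ hgg₀ hg hCC₀ hC hs hs₁ hs₂ v u₁ u₂ φ₁₂ φ₂₁)))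

omit [NumberField F] [Algebra.IsQuadraticExtension F E] in
/-- inverses pass through `g (u₁ ⊕ᶠ u₂) g⁻¹`: `(v, g (u₁ ⊕ᶠ u₂) g⁻¹)⁻¹ = (v⁻¹, g (u₁⁻¹ ⊕ᶠ u₂⁻¹) g⁻¹)`. [folklore] -/
theorem prod_isometryConj_blockDiag_inv (v : adelic F E c N JV) (u₁ : adelic F E c M₁ J₁) (u₂ : adelic F E c M₂ J₂) :
    (v, adelicIsometryConj F E c (M₁ + M₂) g hg (adelicBlockDiag F E c M₁ M₂ J₁ J₂ (u₁, u₂)))⁻¹ =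
      (v⁻¹, adelicIsometryConj F E c (M₁ + M₂) g hg (adelicBlockDiag F E c M₁ M₂ J₁ J₂ (u₁⁻¹, u₂⁻¹))) :=
  Prod.ext rfl
    (((map_inv (adelicIsometryConj F E c (M₁ + M₂) g hg) _).symm).trans
      (congrArg (adelicIsometryConj F E c (M₁ + M₂) g hg) (map_inv (adelicBlockDiag F E c M₁ M₂ J₁ J₂) (u₁, u₂)).symm))

/-- **The theta KERNEL of the big pair `(U(J_V), U(J_W))` restricted to the CONJUGATED torus**:
`θ_{Φ₁ ⊗' Φ₂}(x, g (u₁ ⊕ᶠ u₂) g⁻¹) = Θ(ω₁″(x⁻¹,u₁⁻¹) Φ₁) · Θ(ω₂″(x⁻¹,u₂⁻¹) Φ₂)` for the conjugated pure tensor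
`Φ₁ ⊗' Φ₂ = seesawConjTensor Φ₁ Φ₂`. [cite: Kudla1984, §1] -/
theorem thetaKernelDatum_thetaFun_isometryConj_seesawConjTensor [LocallyCompactSpace (adelic F E c N JV)]
    [LocallyCompactSpace (adelic F E c (M₁ + M₂) JW)]
    (hρ : HasThetaMajorants fun (p : adelic F E c N JV × adelic F E c (M₁ + M₂) JW)
      (Φ : piSchwartzBruhat F (Fin n)) => pairRep F E c N (M₁ + M₂) eW JV JW s p Φ)
    (SK : Set (piSchwartzBruhat F (Fin n)))
    (hSK : ∀ (h : adelic F E c (M₁ + M₂) JW) (Φ : piSchwartzBruhat F (Fin n)), Φ ∈ SK →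
      pairRep F E c N (M₁ + M₂) eW JV JW s (1, h) Φ ∈ SK)
    (x : adelic F E c N JV) (u₁ : adelic F E c M₁ J₁) (u₂ : adelic F E c M₂ J₂)
    (Φ₁ : piSchwartzBruhat F (Fin N × Fin M₁)) (Φ₂ : piSchwartzBruhat F (Fin N × Fin M₂)) :
    (thetaKernelDatum F E c N (M₁ + M₂) eW JV JW hcδ hδ hd hV hW hVd hTWd hJV hJW s hs hρ SK hSK).thetaFun
        (seesawConjTensor F E c N M₁ M₂ eW JV JW J₁ J₂ hcδ hδ hd hV hW h₁ h₂ hVd hTWd hT hJV hJW hJ₁ hJ₂ hgg₀ hg hCC₀ hC Φ₁ Φ₂)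
        (x, adelicIsometryConj F E c (M₁ + M₂) g hg (adelicBlockDiag F E c M₁ M₂ J₁ J₂ (u₁, u₂))) =
      thetaDistLM F (Fin N × Fin M₁) (seesawConjRep₁ F E c N M₁ M₂ eW e₁ e₂ JV JW J₁ J₂ hcδ hδ hd hV hW h₁ h₂ hVd hTWd h₁d h₂d hT hJV hJW hJ₁ hJ₂ hgg₀ hg hCC₀ hC hs hs₁ hs₂ (x⁻¹, u₁⁻¹) Φ₁) *
        thetaDistLM F (Fin N × Fin M₂) (seesawConjRep₂ F E c N M₁ M₂ eW e₁ e₂ JV JW J₁ J₂ hcδ hδ hd hV hW h₁ h₂ hVd hTWd h₁d h₂d hT hJV hJW hJ₁ hJ₂ hgg₀ hg hCC₀ hC hs hs₁ hs₂ (x⁻¹, u₂⁻¹) Φ₂) :=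
  ((thetaKernelDatum F E c N (M₁ + M₂) eW JV JW hcδ hδ hd hV hW hVd hTWd hJV hJW s hs hρ SK hSK).thetaFun_apply
        (seesawConjTensor F E c N M₁ M₂ eW JV JW J₁ J₂ hcδ hδ hd hV hW h₁ h₂ hVd hTWd hT hJV hJW hJ₁ hJ₂ hgg₀ hg hCC₀ hC Φ₁ Φ₂)
        (x, adelicIsometryConj F E c (M₁ + M₂) g hg (adelicBlockDiag F E c M₁ M₂ J₁ J₂ (u₁, u₂)))).trans
    ((congrArg (fun p : adelic F E c N JV × adelic F E c (M₁ + M₂) JW =>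
        thetaDistLM F (Fin n) (pairRep F E c N (M₁ + M₂) eW JV JW s p (seesawConjTensor F E c N M₁ M₂ eW JV JW J₁ J₂ hcδ hδ hd hV hW h₁ h₂ hVd hTWd hT hJV hJW hJ₁ hJ₂ hgg₀ hg hCC₀ hC Φ₁ Φ₂)))
        (prod_isometryConj_blockDiag_inv F E c N M₁ M₂ JV JW J₁ J₂ hg x u₁ u₂)).trans
      (thetaDistLM_pairRep_isometryConj_seesawConjTensor F E c N M₁ M₂ eW e₁ e₂ JV JW J₁ J₂ hcδ hδ hd hV hW h₁ h₂ hVd hTWd h₁d h₂d hT hJV hJW hJ₁ hJ₂ hgg₀ hg hCC₀ hC hs hs₁ hs₂ x⁻¹ u₁⁻¹ u₂⁻¹ Φ₁ Φ₂))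

end ThirtyFour

end UnitaryDualPair

end Literature.NumberTheory.GelbartRogawski1991

end

/-! ### Build-lane note (ops-buildfix G11b-3 recipe v2, LEDGER B13-1/B14-5/B14-7, 2026-08-22)
`lean -o` (the hub build lane, never `lean`/the gate check) runs Lean 4.32's library-suggestion indexers
(`Lean.LibrarySuggestions.SymbolFrequency` / `SineQuaNon`, from their `exportEntriesFn`) over the statement of every local
theorem constant that is not a denied premise; on this family's statements (very large dependent binder telescopes) that fold
runs for tens of minutes (incident G11b-3, run/shared/lean/ops/buildfix/G11b-3-DOSSIER.md). `isDeniedPremise` skips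
`[implicit_reducible]` constants before any fold, and the status is inert on theorems (Meta never unfolds `thmInfo`).
v2 form: ONE file-final, top-level `local` attribute — it goes through the synchronous scoped reducibility extension that
`getReducibilityStatusCore` reads first, so it needs no `set_option Elab.async false` (parallel elaboration stays on), also
reaches auto-realized `*.congr_simp` / structure-projection theorem constants, is never popped before export, and is not
exported. No statement or proof is changed. -/
set_option allowUnsafeReducibility true in
attribute [local implicit_reducible]
  Literature.NumberTheory.GelbartRogawski1991.UnitaryDualPair.thetaDistLM_mpSeesaw_tensorToSum
  Literature.NumberTheory.GelbartRogawski1991.UnitaryDualPair.thetaDistLM_mpSeesaw_tensorToSum_eq_char_mul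
  Literature.NumberTheory.GelbartRogawski1991.UnitaryDualPair.seesawTensor_apply
  Literature.NumberTheory.GelbartRogawski1991.UnitaryDualPair.seesawWedge_def
  Literature.NumberTheory.GelbartRogawski1991.UnitaryDualPair.seesawWedge_swap
  Literature.NumberTheory.GelbartRogawski1991.UnitaryDualPair.seesawWedge_self
  Literature.NumberTheory.GelbartRogawski1991.UnitaryDualPair.seesawRep₁_apply
  Literature.NumberTheory.GelbartRogawski1991.UnitaryDualPair.seesawRep₂_apply
  Literature.NumberTheory.GelbartRogawski1991.UnitaryDualPair.thetaDistLM_omega_seesawBigSum_tensorToSum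
  Literature.NumberTheory.GelbartRogawski1991.UnitaryDualPair.thetaDistLM_pairRep_blockDiag_seesawTensor
  Literature.NumberTheory.GelbartRogawski1991.UnitaryDualPair.thetaDistLM_pairRep_blockDiag_seesawTensor_eq_char_mul
  Literature.NumberTheory.GelbartRogawski1991.UnitaryDualPair.thetaDistLM_pairRep_blockDiag_seesawWedge
  Literature.NumberTheory.GelbartRogawski1991.UnitaryDualPair.prod_blockDiag_inv
  Literature.NumberTheory.GelbartRogawski1991.UnitaryDualPair.thetaKernelDatum_thetaFun_blockDiag_seesawTensor
  Literature.NumberTheory.GelbartRogawski1991.UnitaryDualPair.thetaKernelDatum_thetaFun_blockDiag_seesawWedge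
  Literature.NumberTheory.GelbartRogawski1991.UnitaryDualPair.seesawConjTensor_apply
  Literature.NumberTheory.GelbartRogawski1991.UnitaryDualPair.seesawConjWedge_def
  Literature.NumberTheory.GelbartRogawski1991.UnitaryDualPair.seesawConjRep₁_apply
  Literature.NumberTheory.GelbartRogawski1991.UnitaryDualPair.seesawConjRep₂_apply
  Literature.NumberTheory.GelbartRogawski1991.UnitaryDualPair.char₃_eq_one_of_rational
  Literature.NumberTheory.GelbartRogawski1991.UnitaryDualPair.char₄_eq_one_of_rational
  Literature.NumberTheory.GelbartRogawski1991.UnitaryDualPair.thetaDistLM_omega_seesawConjSum_tensorToSum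
  Literature.NumberTheory.GelbartRogawski1991.UnitaryDualPair.thetaDistLM_pairRep_isometryConj_seesawConjTensor
  Literature.NumberTheory.GelbartRogawski1991.UnitaryDualPair.thetaDistLM_pairRep_isometryConj_seesawConjTensor_eq_char_mul
  Literature.NumberTheory.GelbartRogawski1991.UnitaryDualPair.thetaDistLM_pairRep_isometryConj_seesawConjWedge
  Literature.NumberTheory.GelbartRogawski1991.UnitaryDualPair.prod_isometryConj_blockDiag_inv
  Literature.NumberTheory.GelbartRogawski1991.UnitaryDualPair.thetaKernelDatum_thetaFun_isometryConj_seesawConjTensor
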